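import Summits.Ventures.PercRepro.MSTightConjTTheorem
import Summits.Ventures.PercRepro.MSTightTighteningSplit

/-!
# Corollaries of Theorem (T): the type-I differences are the partner differences

Dossier proofs/MINE1-theoremS.md, Addendum 56 supplement 2 — the original form of Conjecture (T)
(Addendum 44): at a tightening direction `r` of an excess-one family `F` with `∅, univ ∉ F`, empty
core and full support, `Y = X ∩ Y` (`diffsY_eq_inter_of_genuine`), so by the excess split
`Y = K \\ K ⊔ {e}` in case (α) (`K` tight, one extra difference `e`) and `Y = K \\ K` in case (β)
(`diffsY_eq_of_genuine`); in particular `|Y| = |K| + 1` and `X = D(P)` (MSTightConjTCandidate's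
`card_diffsY_of_conjT`, `diffsX_eq_diffs_proj_of_conjT` at `conjT`).
-/

namespace PercRepro.MSTight

open Finset
open scoped FinsetFamily

variable {α : Type*} [DecidableEq α] [Fintype α] {r : α} {F : Finset (Finset α)}

/-- `Y = X ∩ Y` at every tightening direction of a genuine excess-one family. -/
theorem diffsY_eq_inter_of_genuine (hF : (F \\ F).card = F.card + 1) (hE : (∅ : Finset α) ∉ F)
    (hU : (univ : Finset α) ∉ F) (hcore : ∀ a, ∃ t ∈ F, a ∉ t) (hsupp : ∀ a, ∃ t ∈ F, a ∈ t)
    (hP : Tight (proj r F)) : diffsY r F = diffsX r F ∩ diffsY r F :=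
  (inter_eq_right.2 (conjT F r hF hE hU hcore hsupp hP)).symm

/-- **Theorem (T) in its original form.** At a tightening direction of a genuine excess-one
family, either the partner family `K` is tight and `Y = K \\ K` plus one extra difference, or
`|K \\ K| = |K| + 1` and `Y = K \\ K`. -/
theorem diffsY_eq_of_genuine (hF : (F \\ F).card = F.card + 1) (hE : (∅ : Finset α) ∉ F)
    (hU : (univ : Finset α) ∉ F) (hcore : ∀ a, ∃ t ∈ F, a ∉ t) (hsupp : ∀ a, ∃ t ∈ F, a ∈ t)
    (hP : Tight (proj r F)) :
    (Tight (partner r F) ∧ ∃ e, e ∉ partner r F \\ partner r F ∧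
      diffsY r F = insert e (partner r F \\ partner r F)) ∨
    ((partner r F \\ partner r F).card = (partner r F).card + 1 ∧
      diffsY r F = partner r F \\ partner r F) := by
  have hY := diffsY_eq_inter_of_genuine hF hE hU hcore hsupp hP
  rcases tightening_split hF hP with ⟨hT, e, he, hXY⟩ | ⟨hβ, hXY, -, -⟩
  · exact Or.inl ⟨hT, e, he, by rw [hY, hXY]⟩
  · exact Or.inr ⟨hβ, by rw [hY, hXY]⟩

/-- `|Y| = |K| + 1` at every tightening direction of a genuine excess-one family. -/
theorem card_diffsY_of_genuine (hF : (F \\ F).card = F.card + 1) (hE : (∅ : Finset α) ∉ F)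
    (hU : (univ : Finset α) ∉ F) (hcore : ∀ a, ∃ t ∈ F, a ∉ t) (hsupp : ∀ a, ∃ t ∈ F, a ∈ t)
    (hP : Tight (proj r F)) : (diffsY r F).card = (partner r F).card + 1 := by
  rw [diffsY_eq_inter_of_genuine hF hE hU hcore hsupp hP]
  exact (tight_proj_iff_card_edges hF r).1 hP

/-- `X = D(P)` at every tightening direction of a genuine excess-one family. -/
theorem diffsX_eq_diffs_proj_of_genuine' (hF : (F \\ F).card = F.card + 1)
    (hE : (∅ : Finset α) ∉ F) (hU : (univ : Finset α) ∉ F) (hcore : ∀ a, ∃ t ∈ F, a ∉ t)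
    (hsupp : ∀ a, ∃ t ∈ F, a ∈ t) (hP : Tight (proj r F)) :
    diffsX r F = proj r F \\ proj r F := by
  rw [diffs_proj_eq]
  exact (union_eq_left.2 (conjT F r hF hE hU hcore hsupp hP)).symm

end PercRepro.MSTight
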